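import Summits.QuantumFields.BalabanUV.Beta.FP.PerfectObjectsT
import Summits.QuantumFields.BalabanUV.Beta.D1BFx.DressedBubbleBridge
import Literature.MathematicalPhysics.QuantumFieldTheory.Balaban1983to89.Beta.HessKerSchur

/-!
# `BalabanUV.Beta.FP.PerfectBubbleExpansion` — road «FP» for binder row D1, leaf N7 ∕ `hrep` (REP∞), sub-leaves ALG-0 «split» and
# ALG-1 «bilinear expansion» of the owner's `REP-DESIGN.md`: THE (1.22) SECOND MOMENT OF A RESOLVENT HESSIAN KERNEL SPLITS INTO ITS
# TADPOLE AND BUBBLE MOMENTS, AND THE BUBBLE OF TWO `Π`-DRESSED CHAIN-RULE VERTICES `axVertexOfK K n S` IS THE `h ⊗ h`-SUPERPOSITION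
# OF THE STENCIL BUBBLES, `h_{μy}(κ′,u) := (Π colH K n μ y)(κ′,u) = colH (legAx₁ n K) n μ y κ′ u`

HONEST FRAMING (cell contract, verbatim): «discharging `BetaPertH` makes Bałaban's UV stability UNCONDITIONAL — a real
constructive-QFT result; it is NOT the continuum limit and NOT the Clay problem.»  [folklore] bookkeeping of absolutely convergent
lattice series, composed BY NAME from the tree: `ExpKernelCalculus.decay510_hessKer` (each half separately, via the zero vertex ∕ zero
table), `DecimatedMomentLimit.summable_coord2_mul_of_decay510`, `AxialDressing.decays_legAx₁` + `OneStepKernelFamily.abs_colH_le` (the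
`Π`-dressed `ℋ`-column decays from the coarse bond), `AxialProjector.axProj_shift` (coarse covariance of the weights), road BF-x's leaf A4
part 1 `D1BFx.DressedBubbleBridge.bubble_wsum_wsum` ∕ `bubble_finset_sum_right` + `KernelWardRelative.bubble_finset_sum_left` (the series
exchange, generic in the dimension and the fibre — NOTHING re-proved here).  No definition, no `def … : Prop`, nothing cited, nothing of
the manuscripts under audit asserted; 0 estimates of leaf N7 proved; 0∕4 binders of row D1 instantiated.  Value = kernel bookkeeping for
road FP (skeleton `HOME/beta/skeletons/D1-b2b-balaban-beta-d1-p3.md`; owner's `REP-DESIGN.md` rows ALG-0∕ALG-1; claim table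
`HOME/b2b-balaban-beta-d1-p3/LEAVES-FP.md` sub-row REP-ALG-0∕1), NOT summit progress; NOT `hasym`, NOT D1, NOT BetaPertH, NOT continuum, NOT Clay.
HONEST DEPENDENCY (verbatim): continuum YM on T⁴ ⇐ BetaPertH ∧ nine spine estimates (0/9 proved); BetaPertH ⇐ (D1) ∧ (D4) ∧
CAP+tail; G-an2-4 gates asym, D1 and NE2/3/4.

WHY.  Road FP's END binder `hrep` (`FP/AsymptoticEnd.hasym_of_legInterface_ref`) is a statement about the perfect coefficient
`fPerf … m = secondMoment (TPerfOf n K S W) μ ν`, `TPerfOf n K S W = hessKer (axDressK n K) (axVertexOfK K n S) W` (`FP/PerfectObjectsT`).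
The owner's chain `g m = TAD + BUB; BUB = base-point average of the fine second moment of the fine bubble kernel` starts with the two
identities of this file: (ALG-0) the second moment is `½·M₂(tadpole) − ½·M₂(bubble)` as soon as both halves have the (5.10)-shape decay,
and (ALG-1) the bubble of the `Π`-dressed vertices is ONE absolutely convergent `ℤ^{d+1} × ℤ^{d+1}` series of stencil bubbles
`B_{κ′λ′}(u,u′) := bubble A (S κ′ u) (S λ′ u′)` against the weights `h_{μy}(κ′,u)·h_{νy′}(λ′,u′)`.  The KEY (definitional) IDENTITY is
`axProj n (colH K n μ y) κ′ = colH (legAx₁ n K) n μ y κ′`: `Π` applied to the `ℋ`-column of `K` IS the `ℋ`-column of `legAx₁ n K`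
(`Π` on the first leg), so `axVertexOfK K n S = vertexOfK (legAx₁ n K) n S` and every weight bound is a column bound of a decaying kernel.
ALG-2 (periodic transport: the coarse second moment of BUB as the base-point AVERAGE of the fine second moments, with the owner's units
bookkeeping constant) is NOT in this file; its inputs `B`, `h` and the coarse covariance `h_{νz}(κ′,u′) = h_{ν0}(κ′, u′ − n•z)` are stated
here BY NAME for its claimant.

CONTENT (all [folklore]):
* §1 (ALG-0, any dimension `D`, any finite fibre `F`) `vertexFamily_zero`, `vertexFamily₂_zero`, `hessKer_zero_V`, `hessKer_zero_W`,
  `exists_decay510_tadpolePart`, `exists_decay510_bubblePart`, `absMoment₂_tadpolePart`, `absMoment₂_bubblePart`,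
  `summable_coord2_tadpolePart`, `summable_coord2_bubblePart`, **`secondMoment_hessKer_split`**.
* §2 (ALG-1, fibre `Fib d`) `axProj_colH`, `axVertexOfK_eq_vertexOfK_legAx₁` (+ `HessKerSchur.vertexOfK_eq_sum` BY NAME), `expWeight_colH`,
  `expWeight_axProj_colH`, `loc_wsum_colH`, `loc_vertexOfK`, **`bubble_vertexOfK`**, **`bubble_axVertexOfK`**, `summable_bubbleSeries`.
* §3 (coarse covariance of the weights) `colH_of_blockCov`, `axProj_colH_of_blockCov`.
* §4 (the literal perfect shape, `d = 3`) **`secondMoment_TPerfOf_split`**, **`bubble_TPerfOf_vertices`** — hypotheses EXACTLY the END's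
  class sockets by type (`Decays K C δ` = `FP/StepLawKHolds.exists_decays_KPerf_holds`, `LocStencil S Cs δs` = `hSinf`,
  `VertexFamily₂ W n Cw δw` = `hWinf`, `1 ≤ n`).
-/

namespace Summit.QuantumFields.BalabanUV.Beta.FP.PerfectBubbleExpansion

open Finset
open scoped BigOperators
open Literature.MathematicalPhysics.QuantumFieldTheory.Balaban1983to89
open Literature.MathematicalPhysics.QuantumFieldTheory.Balaban1983to89.Beta
open B12Sec2to5 (l1 l1_nonneg Decay510)
open ExpKernelCalculus (Site MKer Decays BiLoc comp tr bubble tadpole hessKer VertexFamily VertexFamily₂ shiftK decay510_hessKer)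
open DecimatedMomentSummable (AbsMoment₂ absMoment₂_of_decay510)
open DecimatedMomentLimit (summable_coord2_mul_of_decay510)
open OneStepResolventKernel (Fib wsum LocStencil)
open OneStepKernelFamily (colH vertexOfK abs_colH_le)
open HessKerSchur (vertexOfK_eq_sum)
open AveragingContours (shift)
open AxialProjector (axProj axProj_shift)
open AxialDressing (legAx₁ legAx₁_inl axDressK axVertexOfK decays_legAx₁ decays_axDressK cAx cAx_nonneg)
open StepDriftWitness (tadpole_zero)
open Summit.QuantumFields.BalabanUV.Beta.TameKernelCalculus
open Summit.QuantumFields.BalabanUV.Beta.KernelWardRelative (loc_finset_sum bubble_finset_sum_left bubble_zero_left)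
open Summit.QuantumFields.BalabanUV.Beta.D1BFx.DressedBubbleBridge
open Summit.QuantumFields.BalabanUV.Beta.FP.PerfectObjectsT (TPerfOf)

noncomputable section

/-! ## §1 ALG-0: the second moment of a resolvent Hessian kernel splits into its tadpole and bubble moments -/

section Split

variable {D : ℕ} {F : Type*} [Fintype F]

omit [Fintype F] in
/-- [folklore] The zero first-order vertex family is a vertex family with constant `0` at any rate. -/
theorem vertexFamily_zero (N : ℕ) (δ : ℝ) : VertexFamily (0 : Fin D → Site D → MKer D F) N 0 δ := by
  intro μ y x z a b
  simp only [Pi.zero_apply, abs_zero, zero_mul, le_refl]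

omit [Fintype F] in
/-- [folklore] The zero second-order table family is a vertex family with constant `0` at any rate. -/
theorem vertexFamily₂_zero (N : ℕ) (δ : ℝ) : VertexFamily₂ (0 : Fin D → Site D → Fin D → Site D → MKer D F) N 0 δ := by
  intro μ y ν y' x z a b
  simp only [Pi.zero_apply, abs_zero, zero_mul, le_refl]

/-- [folklore] With the zero first-order vertex the resolvent Hessian kernel is the tadpole half: `hessKer A 0 W μ ν z = ½·tadpole A (W μ 0 ν z)`. -/
theorem hessKer_zero_V (A : MKer D F) (W : Fin D → Site D → Fin D → Site D → MKer D F) (μ ν : Fin D) (z : Site D) :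
    hessKer A 0 W μ ν z = (1 / 2) * tadpole A (W μ 0 ν z) := by
  simp only [ExpKernelCalculus.hessKer, Pi.zero_apply, bubble_zero_left, mul_zero, sub_zero]

/-- [folklore] With the zero table the resolvent Hessian kernel is minus the bubble half: `hessKer A V 0 μ ν z = −½·bubble A (V μ 0) (V ν z)`. -/
theorem hessKer_zero_W (A : MKer D F) (V : Fin D → Site D → MKer D F) (μ ν : Fin D) (z : Site D) :
    hessKer A V 0 μ ν z = -((1 / 2) * bubble A (V μ 0) (V ν z)) := by
  simp only [ExpKernelCalculus.hessKer, Pi.zero_apply, tadpole_zero, mul_zero, zero_sub]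

/-- [folklore] **THE TADPOLE HALF HAS THE (5.10)-SHAPE DECAY**: spread `A`, a localised second-order table family (blocking `N ≥ 1`) ⟹
`z ↦ tadpole A (W μ 0 ν z)` is `Decay510` with some constant `≥ 0` and some rate `> 0` (`decay510_hessKer` at the zero vertex, rates unified). -/
theorem exists_decay510_tadpolePart {A : MKer D F} {W : Fin D → Site D → Fin D → Site D → MKer D F} {N : ℕ} (hA : Spr A)
    (hW : ∃ Cw δw : ℝ, 0 < δw ∧ VertexFamily₂ W N Cw δw) (hN : 1 ≤ N) (μ ν : Fin D) :
    ∃ C r : ℝ, 0 ≤ C ∧ 0 < r ∧ Decay510 (fun z => tadpole A (W μ 0 ν z)) C r := by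
  obtain ⟨CA, δA, hδA, hAd⟩ := hA
  obtain ⟨Cw, δw, hδw, hWl⟩ := hW
  have hm : 0 < min δA δw := lt_min hδA hδw
  have hA' : Decays A (|CA|) (min δA δw) := decays_of_le hAd (min_le_left _ _)
  have hW' : VertexFamily₂ W N (|Cw|) (min δA δw) := fun μ y ν y' => biLoc_of_le (hWl μ y ν y') (min_le_right _ _)
  obtain ⟨C', hC', h⟩ := decay510_hessKer hA' (vertexFamily_zero (D := D) (F := F) N (min δA δw)) hW' hm hN μ ν
  refine ⟨2 * C', min δA δw / 4, by positivity, by positivity, fun z => ?_⟩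
  have hz := h z
  rw [hessKer_zero_V, abs_mul, abs_of_pos (by norm_num : (0 : ℝ) < 1 / 2)] at hz
  linarith

/-- [folklore] **THE BUBBLE HALF HAS THE (5.10)-SHAPE DECAY**: spread `A`, a localised first-order vertex family (blocking `N ≥ 1`) ⟹
`z ↦ bubble A (V μ 0) (V ν z)` is `Decay510` with some constant `≥ 0` and some rate `> 0` (`decay510_hessKer` at the zero table). -/
theorem exists_decay510_bubblePart {A : MKer D F} {V : Fin D → Site D → MKer D F} {N : ℕ} (hA : Spr A)
    (hV : ∃ Cv δv : ℝ, 0 < δv ∧ VertexFamily V N Cv δv) (hN : 1 ≤ N) (μ ν : Fin D) :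
    ∃ C r : ℝ, 0 ≤ C ∧ 0 < r ∧ Decay510 (fun z => bubble A (V μ 0) (V ν z)) C r := by
  obtain ⟨CA, δA, hδA, hAd⟩ := hA
  obtain ⟨Cv, δv, hδv, hVl⟩ := hV
  have hm : 0 < min δA δv := lt_min hδA hδv
  have hA' : Decays A (|CA|) (min δA δv) := decays_of_le hAd (min_le_left _ _)
  have hV' : VertexFamily V N (|Cv|) (min δA δv) := fun μ y => biLoc_of_le (hVl μ y) (min_le_right _ _)
  obtain ⟨C', hC', h⟩ := decay510_hessKer hA' hV' (vertexFamily₂_zero (D := D) (F := F) N (min δA δv)) hm hN μ ν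
  refine ⟨2 * C', min δA δv / 4, by positivity, by positivity, fun z => ?_⟩
  have hz := h z
  rw [hessKer_zero_W, abs_neg, abs_mul, abs_of_pos (by norm_num : (0 : ℝ) < 1 / 2)] at hz
  linarith

/-- [folklore] The tadpole half has an absolutely summable second moment. -/
theorem absMoment₂_tadpolePart {A : MKer D F} {W : Fin D → Site D → Fin D → Site D → MKer D F} {N : ℕ} (hA : Spr A)
    (hW : ∃ Cw δw : ℝ, 0 < δw ∧ VertexFamily₂ W N Cw δw) (hN : 1 ≤ N) (μ ν : Fin D) :
    AbsMoment₂ (fun z => tadpole A (W μ 0 ν z)) := by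
  obtain ⟨C, r, -, hr, h⟩ := exists_decay510_tadpolePart hA hW hN μ ν
  exact absMoment₂_of_decay510 hr h

/-- [folklore] The bubble half has an absolutely summable second moment. -/
theorem absMoment₂_bubblePart {A : MKer D F} {V : Fin D → Site D → MKer D F} {N : ℕ} (hA : Spr A)
    (hV : ∃ Cv δv : ℝ, 0 < δv ∧ VertexFamily V N Cv δv) (hN : 1 ≤ N) (μ ν : Fin D) :
    AbsMoment₂ (fun z => bubble A (V μ 0) (V ν z)) := by
  obtain ⟨C, r, -, hr, h⟩ := exists_decay510_bubblePart hA hV hN μ ν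
  exact absMoment₂_of_decay510 hr h

/-- [folklore] The second-moment series of the tadpole half converges absolutely (any pair of coordinates). -/
theorem summable_coord2_tadpolePart {A : MKer D F} {W : Fin D → Site D → Fin D → Site D → MKer D F} {N : ℕ} (hA : Spr A)
    (hW : ∃ Cw δw : ℝ, 0 < δw ∧ VertexFamily₂ W N Cw δw) (hN : 1 ≤ N) (μ ν κ l : Fin D) :
    Summable fun z : Site D => (z κ : ℝ) * (z l : ℝ) * tadpole A (W μ 0 ν z) := by
  obtain ⟨C, r, -, hr, h⟩ := exists_decay510_tadpolePart hA hW hN μ ν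
  exact summable_coord2_mul_of_decay510 hr h κ l

/-- [folklore] The second-moment series of the bubble half converges absolutely (any pair of coordinates). -/
theorem summable_coord2_bubblePart {A : MKer D F} {V : Fin D → Site D → MKer D F} {N : ℕ} (hA : Spr A)
    (hV : ∃ Cv δv : ℝ, 0 < δv ∧ VertexFamily V N Cv δv) (hN : 1 ≤ N) (μ ν κ l : Fin D) :
    Summable fun z : Site D => (z κ : ℝ) * (z l : ℝ) * bubble A (V μ 0) (V ν z) := by
  obtain ⟨C, r, -, hr, h⟩ := exists_decay510_bubblePart hA hV hN μ ν
  exact summable_coord2_mul_of_decay510 hr h κ l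

/-- [folklore] **ALG-0 — THE SPLIT.**  For a spread resolvent `A`, a localised first-order vertex family `V` and a localised second-order
table family `W` (blocking `N ≥ 1`), the (1.22) second moment of the resolvent Hessian kernel
`hessKer A V W μ ν z = ½·tadpole A (W μ 0 ν z) − ½·bubble A (V μ 0) (V ν z)` is
`secondMoment (hessKer A V W) μ ν = ½·Σ'_z z_μ z_ν·tadpole A (W μ 0 ν z) − ½·Σ'_z z_μ z_ν·bubble A (V μ 0) (V ν z)`,
both series converging absolutely (§1 above). -/
theorem secondMoment_hessKer_split {A : MKer D F} {V : Fin D → Site D → MKer D F}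
    {W : Fin D → Site D → Fin D → Site D → MKer D F} {N : ℕ} (hA : Spr A)
    (hV : ∃ Cv δv : ℝ, 0 < δv ∧ VertexFamily V N Cv δv) (hW : ∃ Cw δw : ℝ, 0 < δw ∧ VertexFamily₂ W N Cw δw) (hN : 1 ≤ N)
    (μ ν : Fin D) :
    B12Beta.secondMoment (hessKer A V W) μ ν =
      (1 / 2) * ∑' z : Site D, (z μ : ℝ) * (z ν : ℝ) * tadpole A (W μ 0 ν z)
        - (1 / 2) * ∑' z : Site D, (z μ : ℝ) * (z ν : ℝ) * bubble A (V μ 0) (V ν z) := by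
  have ht := summable_coord2_tadpolePart hA hW hN μ ν μ ν
  have hb := summable_coord2_bubblePart hA hV hN μ ν μ ν
  unfold B12Beta.secondMoment
  rw [← tsum_mul_left, ← tsum_mul_left, ← (ht.mul_left (1 / 2)).tsum_sub (hb.mul_left (1 / 2))]
  refine tsum_congr fun z => ?_
  simp only [ExpKernelCalculus.hessKer]
  ring

end Split

/-! ## §2 ALG-1: the bubble of two `Π`-dressed chain-rule vertices is the `h ⊗ h`-superposition of the stencil bubbles -/

section Bilinear

variable {d : ℕ}

/-- [folklore] **THE KEY IDENTITY** (definitional): `Π` applied to the `ℋ`-column of `K` at the coarse bond `(μ, y)` IS the `ℋ`-column, at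
the same bond, of `Π`-on-the-first-leg of `K`: `axProj N (colH K N μ y) = colH (legAx₁ N K) N μ y`. -/
theorem axProj_colH (N : ℕ) (K : MKer (d + 1) (Fib d)) (μ : Fin (d + 1)) (y : Fin (d + 1) → ℤ) :
    axProj N (colH K N μ y) = colH (legAx₁ N K) N μ y := by
  funext κ' u
  rfl

/-- [folklore] Hence the `Π`-dressed chain-rule vertex through `K` IS the plain chain-rule vertex through `legAx₁ N K`:
`axVertexOfK K N S = vertexOfK (legAx₁ N K) N S` (as functions of the coarse bond and as kernels). -/
theorem axVertexOfK_eq_vertexOfK_legAx₁ (K : MKer (d + 1) (Fib d)) (N : ℕ)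
    (S : Fin (d + 1) → (Fin (d + 1) → ℤ) → MKer (d + 1) (Fib d)) :
    axVertexOfK K N S = vertexOfK (legAx₁ N K) N S := by
  funext μ y x z a b
  simp only [AxialDressing.axVertexOfK, OneStepKernelFamily.vertexOfK, axProj_colH]

/-- [folklore] The `ℋ`-column weights of a decaying kernel decay exponentially from the coarse bond position `N•y` (`abs_colH_le`, restated in
the «expWeight» shape of `DressedBubbleBridge`). -/
theorem expWeight_colH {K : MKer (d + 1) (Fib d)} {C δ : ℝ} (hK : Decays K C δ) (N : ℕ) (μ : Fin (d + 1))
    (y : Fin (d + 1) → ℤ) (κ' : Fin (d + 1)) :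
    ∀ u, |colH K N μ y κ' u| ≤ C * Real.exp (-δ * l1 (u - (N : ℤ) • y)) :=
  fun u => abs_colH_le hK μ y κ' u

/-- [folklore] **THE `Π`-DRESSED WEIGHTS DECAY FROM THE COARSE BOND**: `|(Π colH K N μ y)(κ′, u)| ≤ cAx·C·e^{−δ|u − N•y|}` for a decaying `K`
(`1 ≤ N`, `0 ≤ δ`; `AxialDressing.decays_legAx₁` through the key identity). -/
theorem expWeight_axProj_colH {N : ℕ} (hN : 1 ≤ N) {K : MKer (d + 1) (Fib d)} {C δ : ℝ} (hK : Decays K C δ) (hδ : 0 ≤ δ)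
    (μ : Fin (d + 1)) (y : Fin (d + 1) → ℤ) (κ' : Fin (d + 1)) :
    ∀ u, |axProj N (colH K N μ y) κ' u| ≤ cAx d N δ * C * Real.exp (-δ * l1 (u - (N : ℤ) • y)) := by
  intro u
  rw [axProj_colH]
  exact abs_colH_le (decays_legAx₁ hN hK hδ) μ y κ' u

/-- [folklore] Each summand `wsum (colH K N μ y κ′) (S κ′)` of the chain-rule vertex is a localised kernel (decaying `K`, local stencils). -/
theorem loc_wsum_colH {N : ℕ} {K : MKer (d + 1) (Fib d)} {C δ : ℝ} (hK : Decays K C δ) (hδ : 0 < δ)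
    {S : Fin (d + 1) → (Fin (d + 1) → ℤ) → MKer (d + 1) (Fib d)} {Cs δs : ℝ} (hS : LocStencil S Cs δs) (hδs : 0 < δs)
    (κ' μ : Fin (d + 1)) (y : Fin (d + 1) → ℤ) : Loc (wsum (colH K N μ y κ') (S κ')) := by
  have hC : 0 ≤ C := hK.nonneg (Sum.inl 0)
  have hm : 0 < min δ δs := lt_min hδ hδs
  exact loc_wsum (fun u => expWeight_of_le (expWeight_colH hK N μ y κ') hC (min_le_left _ _) u) hC
    (fun u => biLoc_of_le (hS κ' u) (min_le_right _ _)) hm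

/-- [folklore] The chain-rule vertex through a decaying `K` of a local stencil family is a localised kernel. -/
theorem loc_vertexOfK {N : ℕ} {K : MKer (d + 1) (Fib d)} {C δ : ℝ} (hK : Decays K C δ) (hδ : 0 < δ)
    {S : Fin (d + 1) → (Fin (d + 1) → ℤ) → MKer (d + 1) (Fib d)} {Cs δs : ℝ} (hS : LocStencil S Cs δs) (hδs : 0 < δs)
    (μ : Fin (d + 1)) (y : Fin (d + 1) → ℤ) : Loc (vertexOfK K N S μ y) := by
  rw [vertexOfK_eq_sum]
  exact loc_finset_sum _ fun κ' => loc_wsum_colH hK hδ hS hδs κ' μ y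

/-- [folklore] **THE BUBBLE OF TWO CHAIN-RULE VERTICES THROUGH A DECAYING `K`** is the `ℋ ⊗ ℋ`-superposition of the stencil bubbles:
for spread `A`, `Decays K C δ` (`δ > 0`) and a local stencil family `S` (`LocStencil S Cs δs`, `δs > 0`),
`bubble A (vertexOfK K N S μ y) (vertexOfK K N S ν y′)
   = Σ_{κ′} Σ_{λ′} Σ'_{(u,u′)} colH K N μ y κ′ u · colH K N ν y′ λ′ u′ · bubble A (S κ′ u) (S λ′ u′)` —
finite additivity in both slots + `DressedBubbleBridge.bubble_wsum_wsum` (ONE absolutely convergent sum over `ℤ^{d+1} × ℤ^{d+1}` per `(κ′, λ′)`). -/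
theorem bubble_vertexOfK {N : ℕ} {A K : MKer (d + 1) (Fib d)} (hA : Spr A) {C δ : ℝ} (hK : Decays K C δ) (hδ : 0 < δ)
    {S : Fin (d + 1) → (Fin (d + 1) → ℤ) → MKer (d + 1) (Fib d)} {Cs δs : ℝ} (hS : LocStencil S Cs δs) (hδs : 0 < δs)
    (μ ν : Fin (d + 1)) (y y' : Fin (d + 1) → ℤ) :
    bubble A (vertexOfK K N S μ y) (vertexOfK K N S ν y')
      = ∑ κ' : Fin (d + 1), ∑ l' : Fin (d + 1), ∑' q : (Fin (d + 1) → ℤ) × (Fin (d + 1) → ℤ),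
          colH K N μ y κ' q.1 * colH K N ν y' l' q.2 * bubble A (S κ' q.1) (S l' q.2) := by
  have hC : 0 ≤ C := hK.nonneg (Sum.inl 0)
  rw [vertexOfK_eq_sum K N S μ y, vertexOfK_eq_sum K N S ν y',
    bubble_finset_sum_left _ hA (fun κ' => loc_wsum_colH hK hδ hS hδs κ' μ y)
      (loc_finset_sum _ fun l' => loc_wsum_colH hK hδ hS hδs l' ν y')]
  refine Finset.sum_congr rfl fun κ' _ => ?_
  rw [bubble_finset_sum_right _ hA (loc_wsum_colH hK hδ hS hδs κ' μ y) (fun l' => loc_wsum_colH hK hδ hS hδs l' ν y')]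
  refine Finset.sum_congr rfl fun l' _ => ?_
  exact bubble_wsum_wsum hA (expWeight_colH hK N μ y κ') hδ (expWeight_colH hK N ν y' l') hC hδ
    (fun u => hS κ' u) (fun u => hS l' u) hδs

/-- [folklore] **ALG-1 — THE BUBBLE OF TWO `Π`-DRESSED CHAIN-RULE VERTICES** `axVertexOfK K N S` (the first-order vertex of `TPerfOf` and of
every `hessKer (axDressK N K) (axVertexOfK K N S) W`): with the weights `h_{μy}(κ′,u) := axProj N (colH K N μ y) κ′ u`,
`bubble A (axVertexOfK K N S μ y) (axVertexOfK K N S ν y′) = Σ_{κ′} Σ_{λ′} Σ'_{(u,u′)} h_{μy}(κ′,u) · h_{νy′}(λ′,u′) · bubble A (S κ′ u) (S λ′ u′)`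
for spread `A`, `Decays K C δ` (`δ > 0`), `LocStencil S Cs δs` (`δs > 0`), `1 ≤ N` (the key identity + `bubble_vertexOfK` at `legAx₁ N K`). -/
theorem bubble_axVertexOfK {N : ℕ} (hN : 1 ≤ N) {A K : MKer (d + 1) (Fib d)} (hA : Spr A) {C δ : ℝ} (hK : Decays K C δ)
    (hδ : 0 < δ) {S : Fin (d + 1) → (Fin (d + 1) → ℤ) → MKer (d + 1) (Fib d)} {Cs δs : ℝ} (hS : LocStencil S Cs δs)
    (hδs : 0 < δs) (μ ν : Fin (d + 1)) (y y' : Fin (d + 1) → ℤ) :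
    bubble A (axVertexOfK K N S μ y) (axVertexOfK K N S ν y')
      = ∑ κ' : Fin (d + 1), ∑ l' : Fin (d + 1), ∑' q : (Fin (d + 1) → ℤ) × (Fin (d + 1) → ℤ),
          axProj N (colH K N μ y) κ' q.1 * axProj N (colH K N ν y') l' q.2 * bubble A (S κ' q.1) (S l' q.2) := by
  rw [axVertexOfK_eq_vertexOfK_legAx₁, bubble_vertexOfK hA (decays_legAx₁ hN hK hδ.le) hδ hS hδs μ ν y y']
  simp only [axProj_colH]

/-- [folklore] The `(κ′, λ′)` bubble series of ALG-1 converges absolutely (weights absolutely summable, stencil bubbles uniformly bounded: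
`DressedBubbleBridge.exists_bubble_bound`). -/
theorem summable_bubbleSeries {N : ℕ} (hN : 1 ≤ N) {A K : MKer (d + 1) (Fib d)} (hA : Spr A) {C δ : ℝ} (hK : Decays K C δ)
    (hδ : 0 < δ) {S : Fin (d + 1) → (Fin (d + 1) → ℤ) → MKer (d + 1) (Fib d)} {Cs δs : ℝ} (hS : LocStencil S Cs δs)
    (hδs : 0 < δs) (μ ν κ' l' : Fin (d + 1)) (y y' : Fin (d + 1) → ℤ) :
    Summable fun q : (Fin (d + 1) → ℤ) × (Fin (d + 1) → ℤ) =>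
      axProj N (colH K N μ y) κ' q.1 * axProj N (colH K N ν y') l' q.2 * bubble A (S κ' q.1) (S l' q.2) := by
  have hw := summable_abs_of_expWeight (expWeight_axProj_colH hN hK hδ.le μ y κ') hδ
  have hw' := summable_abs_of_expWeight (expWeight_axProj_colH hN hK hδ.le ν y' l') hδ
  obtain ⟨B, hB0, hB⟩ := exists_bubble_bound hA (fun u => hS κ' u) (fun u => hS l' u) hδs
  refine Summable.of_norm_bounded ((hw.mul_of_nonneg hw' (fun u => abs_nonneg _) (fun u => abs_nonneg _)).mul_right B)
    (fun q => ?_)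
  rw [Real.norm_eq_abs, abs_mul, abs_mul]
  exact mul_le_mul_of_nonneg_left (hB q.1 q.2) (mul_nonneg (abs_nonneg _) (abs_nonneg _))

end Bilinear

/-! ## §3 Coarse covariance of the weights (input of ALG-2) -/

section Covariance

variable {d : ℕ}

/-- [folklore] **COARSE COVARIANCE OF THE `ℋ`-COLUMN**: if `K` is invariant under simultaneous coarse translations
(`shiftK (−N•t) K = K` for every `t`, the shape of `FP/SymmetryK.shiftK_KPerf`), then the column at the coarse bond `(ν, z)` is the column at
`(ν, 0)` translated by `N•z`: `colH K N ν z κ′ u′ = colH K N ν 0 κ′ (u′ − N•z)`. -/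
theorem colH_of_blockCov {N : ℕ} {K : MKer (d + 1) (Fib d)} (hKcov : ∀ t : Fin (d + 1) → ℤ, shiftK (-((N : ℤ) • t)) K = K)
    (ν : Fin (d + 1)) (z : Fin (d + 1) → ℤ) (κ' : Fin (d + 1)) (u' : Fin (d + 1) → ℤ) :
    colH K N ν z κ' u' = colH K N ν 0 κ' (u' - (N : ℤ) • z) := by
  have h := congrFun (congrFun (hKcov z) u') ((N : ℤ) • z)
  simp only [ExpKernelCalculus.shiftK] at h
  simp only [OneStepKernelFamily.colH, smul_zero]
  rw [← h, add_neg_cancel, ← sub_eq_add_neg]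

/-- [folklore] **COARSE COVARIANCE OF THE `Π`-DRESSED WEIGHTS** (`Π` commutes with coarse translations, `AxialProjector.axProj_shift`):
`(Π colH K N ν z)(κ′, u′) = (Π colH K N ν 0)(κ′, u′ − N•z)` for a coarse-translation invariant `K` and `1 ≤ N`. -/
theorem axProj_colH_of_blockCov {N : ℕ} (hN : 1 ≤ N) {K : MKer (d + 1) (Fib d)}
    (hKcov : ∀ t : Fin (d + 1) → ℤ, shiftK (-((N : ℤ) • t)) K = K)
    (ν : Fin (d + 1)) (z : Fin (d + 1) → ℤ) (κ' : Fin (d + 1)) (u' : Fin (d + 1) → ℤ) :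
    axProj N (colH K N ν z) κ' u' = axProj N (colH K N ν 0) κ' (u' - (N : ℤ) • z) := by
  have hcol : colH K N ν z = shift ((N : ℤ) • (-z)) (colH K N ν 0) := by
    funext κ u
    rw [colH_of_blockCov hKcov ν z κ u]
    simp only [AveragingContours.shift, smul_neg, ← sub_eq_add_neg]
  rw [hcol, axProj_shift hN]
  simp only [AveragingContours.shift, smul_neg, ← sub_eq_add_neg]

end Covariance

/-! ## §4 The literal perfect shape `TPerfOf n K S W` (dimension four) -/

section Perfect

/-- [folklore] **ALG-0 AT THE PERFECT SHAPE**: for a decaying packed resolvent `K`, a local stencil family `S` and a localised table family `W`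
at blocking `n ≥ 1` (EXACTLY the class sockets of road FP's END: `FP/StepLawKHolds.exists_decays_KPerf_holds`, `hSinf`, `hWinf`),
`secondMoment (TPerfOf n K S W) μ ν = ½·Σ'_z z_μ z_ν·tadpole (axDressK n K) (W μ 0 ν z) − ½·Σ'_z z_μ z_ν·bubble (axDressK n K) (V μ 0) (V ν z)`
with `V := axVertexOfK K n S` (the `Π`-conjugated resolvent is spread: `AxialDressing.decays_axDressK`; `V` is a vertex family:
`AxialDressing.vertexFamily_axVertexOfK'`). -/
theorem secondMoment_TPerfOf_split {n : ℕ} (hn : 1 ≤ n) {K : MKer (3 + 1) (Fib 3)} {C δ : ℝ} (hK : Decays K C δ) (hδ : 0 < δ)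
    {S : Fin (3 + 1) → (Fin (3 + 1) → ℤ) → MKer (3 + 1) (Fib 3)} {Cs δs : ℝ} (hS : LocStencil S Cs δs) (hδs : 0 < δs)
    {W : Fin (3 + 1) → (Fin (3 + 1) → ℤ) → Fin (3 + 1) → (Fin (3 + 1) → ℤ) → MKer (3 + 1) (Fib 3)} {Cw δw : ℝ}
    (hW : VertexFamily₂ W n Cw δw) (hδw : 0 < δw) (μ ν : Fin (3 + 1)) :
    B12Beta.secondMoment (TPerfOf n K S W) μ ν =
      (1 / 2) * ∑' z : Fin (3 + 1) → ℤ, (z μ : ℝ) * (z ν : ℝ) * tadpole (axDressK n K) (W μ 0 ν z)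
        - (1 / 2) * ∑' z : Fin (3 + 1) → ℤ, (z μ : ℝ) * (z ν : ℝ) *
            bubble (axDressK n K) (axVertexOfK K n S μ 0) (axVertexOfK K n S ν z) := by
  haveI : NeZero n := ⟨by omega⟩
  have hA : Spr (axDressK n K) := ⟨_, δ, hδ, decays_axDressK hn hK hδ.le⟩
  obtain ⟨Cv, δv, hδv, hV⟩ :=
    AxialDressing.vertexFamily_axVertexOfK' (N := n) ⟨δ, C, hδ, hK.nonneg (Sum.inl 0), hK⟩ hS hδs
  exact secondMoment_hessKer_split hA ⟨Cv, δv, hδv, hV⟩ ⟨Cw, δw, hδw, hW⟩ hn μ ν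

/-- [folklore] **ALG-1 AT THE PERFECT SHAPE**: the bubble half of `TPerfOf n K S W` at the coarse separation `z`, expanded —
`bubble (axDressK n K) (axVertexOfK K n S μ 0) (axVertexOfK K n S ν z)
   = Σ_{κ′λ′} Σ'_{(u,u′)} (Π colH K n μ 0)(κ′,u) · (Π colH K n ν z)(λ′,u′) · bubble (axDressK n K) (S κ′ u) (S λ′ u′)`
(the fine bubble kernel `B_{κ′λ′}(u,u′)` of the owner's ALG-2 against the `Π`-dressed `ℋ`-weights). -/
theorem bubble_TPerfOf_vertices {n : ℕ} (hn : 1 ≤ n) {K : MKer (3 + 1) (Fib 3)} {C δ : ℝ} (hK : Decays K C δ) (hδ : 0 < δ)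
    {S : Fin (3 + 1) → (Fin (3 + 1) → ℤ) → MKer (3 + 1) (Fib 3)} {Cs δs : ℝ} (hS : LocStencil S Cs δs) (hδs : 0 < δs)
    (μ ν : Fin (3 + 1)) (z : Fin (3 + 1) → ℤ) :
    bubble (axDressK n K) (axVertexOfK K n S μ 0) (axVertexOfK K n S ν z)
      = ∑ κ' : Fin (3 + 1), ∑ l' : Fin (3 + 1), ∑' q : (Fin (3 + 1) → ℤ) × (Fin (3 + 1) → ℤ),
          axProj n (colH K n μ 0) κ' q.1 * axProj n (colH K n ν z) l' q.2 * bubble (axDressK n K) (S κ' q.1) (S l' q.2) :=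
  bubble_axVertexOfK hn ⟨_, δ, hδ, decays_axDressK hn hK hδ.le⟩ hK hδ hS hδs μ ν 0 z

end Perfect

end

end Summit.QuantumFields.BalabanUV.Beta.FP.PerfectBubbleExpansion
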